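import Literature.Computability.FineGrained.SerfKSatPre
import Literature.Computability.Complexity.Transducers
import HarnessLib

/-!
# SERF reduction of `k`-SAT (parameter `n`) to `k`-SAT (parameter `m`), II: the transducers

Family `fine-grained`. Second file of the machine behind
`Literature.Computability.FineGrained.serfReducible_kSATParam_kSATClauseParam` (Impagliazzo–Paturi–Zane,
JCSS 63 (2001), §2, Cor. 1–2). The step machine of the SERF reduction is a sequential composite
(`Turing.TM2ComputableAux.comp`) of stages over the alphabets `Bool`, `Option Bool`, `Option Γ'`;
the three alphabet-changing stages are finite-state transducers (`Complexity.FST`, linear time by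
`FST.timeComputable_eval`), built and specified here:

* `SerfKSat.inT : FST _ Bool (Option Bool)` — **input splitter**. On the machine input
  `boolPair x ((encodingList Bool).listBool.encode as)` (instance `x`, oracle answers `as`) it
  emits `x` as a field (`x.map some`), the field terminator `none`, one tick `some true` per
  answer received, a second `none`, and the head bit of every answer (`inT_eval`): the answer
  transcript is never parsed again, and its length enters all later running times linearly only.
* `SerfKSat.midT : FST _ (Option Bool) (Option Γ')` — **hand-over to the `Γ'` side**. On the field
  `SerfKSat.preWord g n cs` produced by the Boolean front end (`SerfKSatPre.lean`: flag, `numVars`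
  header, clauses with polarity-first literals) followed by `none` and a context, it emits the
  `Γ'`-code `KCNF.encode ⟨n, cs⟩` as a field, `none`, the flag symbol `bit g`, and the context
  transliterated (`midT_eval`).
* `SerfKSat.outT : FST _ (Option Γ') Bool` — **output projection** `some (bit b) ↦ b` (`outT_eval`).

## References

* R. Impagliazzo, R. Paturi, F. Zane, *Which problems have strongly exponential complexity?*,
  J. Comput. System Sci. 63 (2001) 512–530, §2, Cor. 1–2.
* J. E. Hopcroft, J. D. Ullman, *Introduction to Automata Theory, Languages, and Computation*,
  Addison-Wesley 1979, §2.7 (Mealy machines). (Not held; folklore constructions.)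
-/

namespace Literature.Computability.FineGrained.SerfKSat

open _root_.Computability Complexity Complexity.Com

/-! ### Repetitions -/

/-- Repeating the bits of a constant word. [folklore] -/
theorem repBits_replicate (k n : ℕ) (b : Bool) : repBits k (List.replicate n b) = List.replicate (k * n) b := by
  induction n with
  | zero => simp
  | succ n ih => rw [List.replicate_succ, repBits_cons, ih, Nat.mul_succ, Nat.add_comm, List.replicate_add]

/-! ### The input splitter -/

/-- States of the input splitter: reading the doubled instance (`px`), the unary answer count
(`pu`), the answer items at an item start (`pi`) or inside an item (`pm`); `q`-states hold the
first symbol of a pair. [folklore] -/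
inductive SIn
  | px | pxq (b : Bool)
  | pu | puq (b : Bool)
  | pi | piq (b : Bool)
  | pm | pmq (b : Bool)
  deriving DecidableEq, Fintype

/-- Transition of the input splitter (pairs `bb` of the instance become `some b`, the separator
`01` becomes `none`; pairs `11` of the unary count become ticks `some true`, its end `01` a second
`none`; an item `dbl a ++ 01` becomes the single symbol `some (a.headD false)`). [folklore] -/
def inStep : SIn → Bool → SIn × List (Option Bool)
  | .px, b => (.pxq b, [])
  | .pxq b, b' => if b' = b then (.px, [some b]) else (.pu, [none])
  | .pu, b => (.puq b, [])
  | .puq b, _ => if b then (.pu, [some true]) else (.pi, [none])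
  | .pi, b => (.piq b, [])
  | .piq b, b' => if b' = b then (.pm, [some b]) else (.pi, [some false])
  | .pm, b => (.pmq b, [])
  | .pmq b, b' => if b' = b then (.pm, []) else (.pi, [])

/-- **The input splitter.** [folklore] -/
def inT : FST SIn Bool (Option Bool) where
  init := .px
  step := inStep
  front := fun _ => []
  keep := fun _ => true

/-- The transition of `inT` (definitional). [folklore] -/
@[simp] theorem inT_step (s : SIn) (b : Bool) : inT.step s b = inStep s b := rfl

/-- `inT` keeps its body and prepends nothing. [folklore] -/
theorem inT_eval_eq (w : List Bool) : inT.eval w = (inT.run .px w).2 := by simp [FST.eval, inT]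

/-- The context produced from the answers: one tick per answer, a separator, the head bits.
[folklore] -/
def ansCtx (as : List (List Bool)) : List (Option Bool) :=
  List.replicate as.length (some true) ++ none :: as.map fun a => some (a.headD false)

/-- Inside an item the splitter emits nothing and returns to an item start at the `01`. [folklore] -/
theorem inT_run_pm (a : List Bool) (rest : List Bool) :
    inT.run .pm (repBits 2 a ++ false :: true :: rest) = inT.run .pi rest := by
  induction a with
  | nil => simp [inStep]
  | cons b a ih =>
    rw [repBits_cons, show List.replicate 2 b ++ repBits 2 a ++ false :: true :: rest =
      b :: b :: (repBits 2 a ++ false :: true :: rest) by rfl]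
    simp only [FST.run_cons, inT_step, inStep, if_true, List.nil_append]
    rw [ih]

/-- The items: one head bit per item. [folklore] -/
theorem inT_run_pi (as : List (List Bool)) :
    (inT.run .pi (frames as)).2 = as.map fun a => some (a.headD false) := by
  induction as with
  | nil => simp
  | cons a as ih =>
    rw [frames_cons]
    cases a with
    | nil =>
      rw [show repBits 2 [] ++ [false, true] ++ frames as = false :: true :: frames as by rfl]
      simp only [FST.run_cons, inT_step, inStep, Bool.true_eq_false, if_false, List.map_cons,
        List.headD_nil, List.singleton_append, List.nil_append]
      rw [ih]
    | cons b a =>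
      rw [repBits_cons, show List.replicate 2 b ++ repBits 2 a ++ [false, true] ++ frames as =
        b :: b :: (repBits 2 a ++ false :: true :: frames as) by simp [List.replicate]]
      simp only [FST.run_cons, inT_step, inStep, if_true, List.map_cons, List.headD_cons,
        List.singleton_append, List.nil_append]
      rw [inT_run_pm, ih]

/-- The unary count: one tick per `11`, then `none` at the `01`. [folklore] -/
theorem inT_run_pu (i : ℕ) (rest : List Bool) :
    inT.run .pu (List.replicate (2 * i) true ++ false :: true :: rest) =
      ((inT.run .pi rest).1, List.replicate i (some true) ++ none :: (inT.run .pi rest).2) := by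
  induction i with
  | zero => simp [inStep]
  | succ i ih =>
    rw [show 2 * (i + 1) = (2 * i + 1) + 1 by ring, List.replicate_succ, List.replicate_succ,
      List.cons_append, List.cons_append]
    simp only [FST.run_cons, inT_step, inStep, if_true, List.singleton_append, List.nil_append]
    rw [ih, List.replicate_succ, List.cons_append]

/-- The instance: `bb ↦ some b`, then `none` at the `01`. [folklore] -/
theorem inT_run_px (x : List Bool) (rest : List Bool) :
    inT.run .px (repBits 2 x ++ false :: true :: rest) =
      ((inT.run .pu rest).1, x.map some ++ none :: (inT.run .pu rest).2) := by
  induction x with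
  | nil => simp [inStep]
  | cons b x ih =>
    rw [repBits_cons, show List.replicate 2 b ++ repBits 2 x ++ false :: true :: rest =
      b :: b :: (repBits 2 x ++ false :: true :: rest) by rfl]
    simp only [FST.run_cons, inT_step, inStep, if_true, List.map_cons, List.singleton_append,
      List.nil_append]
    rw [ih, List.cons_append]

/-- The answer transcript as a flat word: `1^{2|as|} 01` and the framed answers. [folklore] -/
theorem listBool_encode_answers (as : List (List Bool)) :
    (encodingList Bool).listBool.encode as = List.replicate (2 * as.length) true ++ false :: true :: frames as := by
  rw [listBool_encode_eq, OracleCompose.unaryEncodeNat_eq_replicate, repBits_replicate]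
  have : frames (as.map (encodingList Bool).encode) = frames as := by
    congr 1; exact List.map_id _
  rw [this]; simp

/-- **The input splitter on a machine input** `⟨x, transcript⟩`: the field `x`, `none`, the
answer context. [folklore] -/
theorem inT_eval (x : List Bool) (as : List (List Bool)) :
    inT.eval (boolPair x ((encodingList Bool).listBool.encode as)) = x.map some ++ none :: ansCtx as := by
  rw [inT_eval_eq, boolPair_eq, listBool_encode_answers,
    show repBits 2 x ++ [false, true] ++ (List.replicate (2 * as.length) true ++ false :: true :: frames as) =
      repBits 2 x ++ false :: true :: (List.replicate (2 * as.length) true ++ false :: true :: frames as) by simp,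
    inT_run_px, inT_run_pu, inT_run_pi, ansCtx]

/-! ### The output projection -/

/-- **The output projection**: `some (bit b) ↦ b`, every other symbol is dropped. [folklore] -/
def outT : FST Unit (Option Γ') Bool where
  init := ()
  step := fun _ a => ((), match a with
    | some (Γ'.bit b) => [b]
    | _ => [])
  front := fun _ => []
  keep := fun _ => true

/-- A word of bits as `Option Γ'`-symbols. [folklore] -/
def bitsO (l : List Bool) : List (Option Γ') := l.map fun b => some (Γ'.bit b)

/-- `bitsO` of a cons. [folklore] -/
@[simp] theorem bitsO_cons (b : Bool) (l : List Bool) : bitsO (b :: l) = some (Γ'.bit b) :: bitsO l := rfl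

/-- `bitsO` of nil. [folklore] -/
@[simp] theorem bitsO_nil : bitsO [] = [] := rfl

/-- `bitsO` is a monoid morphism. [folklore] -/
@[simp] theorem bitsO_append (l l' : List Bool) : bitsO (l ++ l') = bitsO l ++ bitsO l' := List.map_append

/-- Length of `bitsO`. [folklore] -/
@[simp] theorem length_bitsO (l : List Bool) : (bitsO l).length = l.length := List.length_map _

/-- The output projection on a word of bits. [folklore] -/
theorem outT_eval (l : List Bool) : outT.eval (bitsO l) = l := by
  have : ∀ l : List Bool, outT.run () (bitsO l) = ((), l) := by
    intro l
    induction l with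
    | nil => rfl
    | cons b l ih => rw [bitsO_cons, FST.run_cons, ih]; rfl
  rw [FST.eval, this l]; rfl

/-! ### The hand-over transducer: flat words -/

/-- The block of a literal `(v, b)` in the doubled clause code of `preWord`: `b⁸ 0⁴ 1⁴`, the
quadrupled numeral, `0011`. [folklore] -/
def litBlock (l : Literal ℕ) : List Bool :=
  [l.2, l.2, l.2, l.2, l.2, l.2, l.2, l.2, false, false, false, false, true, true, true, true] ++
    (repBits 4 (encodeNat l.1) ++ [false, false, true, true])

/-- The block of a clause: `1^{4k} 0011`, the literal blocks, `01`. [folklore] -/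
def clauseBlock (c : Clause ℕ) : List Bool :=
  List.replicate (4 * c.length) true ++ ([false, false, true, true] ++ (c.flatMap litBlock ++ [false, true]))

/-- The doubled code of a swapped clause is its block. [folklore] -/
theorem repBits_two_swClause (c : Clause ℕ) :
    repBits 2 (swLit.listBool.encode c) ++ [false, true] = clauseBlock c := by
  rw [listBool_encode_eq, OracleCompose.unaryEncodeNat_eq_replicate]
  have hl : ∀ c : Clause ℕ, repBits 2 (frames (c.map swLit.encode)) = c.flatMap litBlock := by
    intro c
    induction c with
    | nil => simp
    | cons l c ih =>
      rw [List.map_cons, frames_cons, repBits_append, repBits_append, ih, List.flatMap_cons,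
        repBits_repBits, swLit_encode, boolPair_eq, repBits_append, repBits_append, repBits_repBits]
      rfl
  rw [repBits_append, repBits_append, hl, repBits_repBits, repBits_replicate, clauseBlock]
  simp

/-- **The flat form of the front-end word**: flag pair, `01`, doubled header, `01`, `1^{2m}`,
`01`, the clause blocks. [folklore] -/
theorem preWord_eq (g : Bool) (n : ℕ) (cs : CNF ℕ) :
    preWord g n cs = g :: g :: false :: true :: (repBits 2 (encodeNat n) ++ false :: true ::
      (List.replicate (2 * cs.length) true ++ false :: true :: cs.flatMap clauseBlock)) := by
  have hf : ∀ cs : CNF ℕ, frames (cs.map swLit.listBool.encode) = cs.flatMap clauseBlock := by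
    intro cs
    induction cs with
    | nil => simp
    | cons c cs ih =>
      rw [List.map_cons, frames_cons, ih, List.flatMap_cons, ← repBits_two_swClause, List.append_assoc]
  rw [preWord, boolPair_eq, boolPair_eq, listBool_encode_eq, hf, OracleCompose.unaryEncodeNat_eq_replicate,
    repBits_replicate]
  simp

/-! ### The hand-over transducer -/

/-- Targets of the skipping states. [folklore] -/
inductive Tgt | hd | lt | dg
  deriving DecidableEq, Fintype

/-- States of the hand-over transducer (`g` is the flag read first; `q`-states hold the first
symbol of a pair; `sk g n t` skips `n + 1` symbols and continues at `t`). [folklore] -/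
inductive SMid
  | f0 | f0q (b : Bool)
  | sk (g : Bool) (n : Fin 14) (t : Tgt)
  | hd (g : Bool) | hdq (g d : Bool)
  | um (g : Bool) | umq (g b : Bool)
  | cs (g : Bool) | csq (g : Bool)
  | uk (g : Bool) | ukq (g b : Bool)
  | lt (g : Bool) | ltq (g b : Bool)
  | dg (g : Bool) | dgq (g b : Bool)
  | d0 (g : Bool)
  | cx
  deriving DecidableEq, Fintype

/-- The state a skip continues at. [folklore] -/
def SMid.tgt (g : Bool) : Tgt → SMid
  | .hd => .hd g
  | .lt => .lt g
  | .dg => .dg g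

/-- The transliteration of a context symbol. [folklore] -/
def cmap : Option Bool → Option Γ'
  | some b => some (Γ'.bit b)
  | none => none

/-- Transition of the hand-over transducer (see `midT_eval` for what it achieves; on the
well-formed inputs of `preWord_eq` every forced symbol is skipped unchecked). [folklore] -/
def midStep : SMid → Option Bool → SMid × List (Option Γ')
  | .f0, some c => (.f0q c, [])
  | .f0q b, _ => (.sk b ⟨1, by decide⟩ .hd, [])
  | .sk g ⟨0, _⟩ t, _ => (SMid.tgt g t, [])
  | .sk g ⟨n + 1, h⟩ t, _ => (.sk g ⟨n, Nat.lt_of_succ_lt h⟩ t, [])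
  | .hd g, some d => (.hdq g d, [])
  | .hdq g d, some d' => if d' = d then (.hd g, [some (Γ'.bit d)]) else (.um g, [some Γ'.comma])
  | .um g, some b => (.umq g b, [])
  | .umq g b, _ => if b then (.um g, []) else (.cs g, [])
  | .cs g, some true => (.csq g, [some Γ'.bra])
  | .cs g, some false => (.sk g ⟨2, by decide⟩ .lt, [some Γ'.bra])
  | .cs g, none => (.cx, [none, some (Γ'.bit g)])
  | .csq g, _ => (.uk g, [])
  | .uk g, some b => (.ukq g b, [])
  | .ukq g b, _ => if b then (.uk g, []) else (.sk g ⟨1, by decide⟩ .lt, [])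
  | .lt g, some b => (.ltq g b, [])
  | .ltq g b, some b' => if b' = b then (.sk g ⟨13, by decide⟩ .dg, [some (Γ'.bit b)]) else (.cs g, [some Γ'.ket])
  | .dg g, some b => (.dgq g b, [])
  | .dgq g b, _ => if b then (.sk g ⟨1, by decide⟩ .dg, [some (Γ'.bit true)]) else (.d0 g, [])
  | .d0 g, some false => (.sk g ⟨0, by decide⟩ .dg, [some (Γ'.bit false)])
  | .d0 g, some true => (.sk g ⟨0, by decide⟩ .lt, [some Γ'.comma])
  | .cx, some b => (.cx, [some (Γ'.bit b)])
  | .cx, none => (.cx, [none])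
  | s, none => (s, [])

/-- **The hand-over transducer.** [folklore] -/
def midT : FST SMid (Option Bool) (Option Γ') where
  init := .f0
  step := midStep
  front := fun _ => []
  keep := fun _ => true

/-- The transition of `midT` (definitional). [folklore] -/
@[simp] theorem midT_step (s : SMid) (a : Option Bool) : midT.step s a = midStep s a := rfl

/-- `midT` keeps its body and prepends nothing. [folklore] -/
theorem midT_eval_eq (w : List (Option Bool)) : midT.eval w = (midT.run .f0 w).2 := by simp [FST.eval, midT]

/-- The last symbol of a skip. [folklore] -/
@[simp] theorem midT_run_sk_zero (g : Bool) (t : Tgt) (h : 0 < 14) (a : Option Bool) (w : List (Option Bool)) :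
    midT.run (.sk g ⟨0, h⟩ t) (a :: w) = midT.run (SMid.tgt g t) w := by
  rw [FST.run_cons, midT_step, midStep]; rfl

/-- One more symbol of a skip. [folklore] -/
@[simp] theorem midT_run_sk_succ (g : Bool) (t : Tgt) (n : ℕ) (h : n + 1 < 14) (a : Option Bool)
    (w : List (Option Bool)) :
    midT.run (.sk g ⟨n + 1, h⟩ t) (a :: w) = midT.run (.sk g ⟨n, Nat.lt_of_succ_lt h⟩ t) w := by
  rw [FST.run_cons, midT_step, midStep]; rfl

/-- The context is transliterated. [folklore] -/
theorem midT_run_cx (C : List (Option Bool)) : midT.run .cx C = (.cx, C.map cmap) := by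
  induction C with
  | nil => rfl
  | cons a C ih =>
    cases a with
    | none => rw [FST.run_cons, midT_step, midStep, ih]; rfl
    | some b => rw [FST.run_cons, midT_step, midStep, ih]; rfl

/-- The quadrupled numeral: one digit per `dddd`, a comma at the terminator `0011`. [folklore] -/
theorem midT_run_dg (g : Bool) (ds : List Bool) (rest : List (Option Bool)) :
    midT.run (.dg g) ((repBits 4 ds).map some ++ some false :: some false :: some true :: some true :: rest) =
      ((midT.run (.lt g) rest).1, bitsO ds ++ some Γ'.comma :: (midT.run (.lt g) rest).2) := by
  induction ds with
  | nil =>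
    rw [repBits_nil, List.map_nil, List.nil_append]
    simp only [FST.run_cons, midT_step, midStep, Bool.false_eq_true, if_false, SMid.tgt, List.nil_append,
      List.singleton_append, bitsO_nil]
  | cons d ds ih =>
    rw [repBits_cons, show (List.replicate 4 d ++ repBits 4 ds).map some ++
        some false :: some false :: some true :: some true :: rest =
        some d :: some d :: some d :: some d :: ((repBits 4 ds).map some ++
          some false :: some false :: some true :: some true :: rest) by simp [List.replicate]]
    cases d
    · simp only [FST.run_cons, midT_step, midStep, Bool.false_eq_true, if_false, SMid.tgt, List.nil_append,
        ih, bitsO_cons, List.cons_append]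
    · simp only [FST.run_cons, midT_step, midStep, if_true, SMid.tgt, List.nil_append, ih, bitsO_cons,
        List.cons_append]

/-- A literal block: the polarity, the digits, a comma — `KCNF.encodeLiteral`. [folklore] -/
theorem midT_run_lit (g : Bool) (l : Literal ℕ) (rest : List (Option Bool)) :
    midT.run (.lt g) ((litBlock l).map some ++ rest) =
      ((midT.run (.lt g) rest).1, (KCNF.encodeLiteral l).map some ++ (midT.run (.lt g) rest).2) := by
  rcases l with ⟨v, b⟩
  rw [litBlock, show ([b, b, b, b, b, b, b, b, false, false, false, false, true, true, true, true] ++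
      (repBits 4 (encodeNat v) ++ [false, false, true, true])).map some ++ rest =
    some b :: some b :: some b :: some b :: some b :: some b :: some b :: some b :: some false :: some false ::
      some false :: some false :: some true :: some true :: some true :: some true ::
      ((repBits 4 (encodeNat v)).map some ++ some false :: some false :: some true :: some true :: rest) by simp]
  simp only [FST.run_cons, midT_step, midStep, if_true, SMid.tgt, midT_run_dg, List.nil_append,
    List.singleton_append]
  simp [KCNF.encodeLiteral, bitsO]

/-- The literal blocks of a clause, then its closing `01`: the clause body and a `ket`. [folklore] -/
theorem midT_run_lits (g : Bool) (c : Clause ℕ) (rest : List (Option Bool)) :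
    midT.run (.lt g) ((c.flatMap litBlock).map some ++ some false :: some true :: rest) =
      ((midT.run (.cs g) rest).1,
        (c.flatMap KCNF.encodeLiteral).map some ++ some Γ'.ket :: (midT.run (.cs g) rest).2) := by
  induction c with
  | nil =>
    rw [List.flatMap_nil, List.map_nil, List.nil_append]
    simp only [FST.run_cons, midT_step, midStep, Bool.true_eq_false, if_false, List.flatMap_nil, List.map_nil,
      List.nil_append, List.singleton_append]
  | cons l c ih =>
    rw [List.flatMap_cons, List.map_append, List.append_assoc, midT_run_lit, ih]
    simp

/-- The unary literal count after its first pair: pairs `11`, then `0011`. [folklore] -/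
theorem midT_run_uk (g : Bool) (j : ℕ) (w : List (Option Bool)) :
    midT.run (.uk g) ((List.replicate (2 * j) true).map some ++ some false :: some false ::
      some true :: some true :: w) = midT.run (.lt g) w := by
  induction j with
  | zero =>
    rw [Nat.mul_zero, List.replicate_zero, List.map_nil, List.nil_append]
    simp only [FST.run_cons, midT_step, midStep, Bool.false_eq_true, if_false, SMid.tgt, List.nil_append]
  | succ j ih =>
    rw [show 2 * (j + 1) = (2 * j + 1) + 1 by ring, List.replicate_succ, List.replicate_succ, List.map_cons,
      List.map_cons, List.cons_append, List.cons_append]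
    simp only [FST.run_cons, midT_step, midStep, if_true, List.nil_append, ih]

/-- A clause block: `KCNF.encodeClause`. [folklore] -/
theorem midT_run_clause (g : Bool) (c : Clause ℕ) (rest : List (Option Bool)) :
    midT.run (.cs g) ((clauseBlock c).map some ++ rest) =
      ((midT.run (.cs g) rest).1, (KCNF.encodeClause c).map some ++ (midT.run (.cs g) rest).2) := by
  rw [clauseBlock]
  cases hc : c.length with
  | zero =>
    rw [Nat.mul_zero, List.replicate_zero, List.nil_append,
      show ([false, false, true, true] ++ (c.flatMap litBlock ++ [false, true])).map some ++ rest =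
        some false :: some false :: some true :: some true ::
          ((c.flatMap litBlock).map some ++ some false :: some true :: rest) by simp]
    simp only [FST.run_cons, midT_step, midStep, SMid.tgt, midT_run_lits, List.singleton_append]
    simp [KCNF.encodeClause]
  | succ j =>
    rw [show 4 * (j + 1) = (2 * (2 * j + 1) + 1) + 1 by ring, List.replicate_succ, List.replicate_succ,
      show (true :: true :: List.replicate (2 * (2 * j + 1)) true ++
          ([false, false, true, true] ++ (c.flatMap litBlock ++ [false, true]))).map some ++ rest =
        some true :: some true :: ((List.replicate (2 * (2 * j + 1)) true).map some ++ some false :: some false ::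
          some true :: some true :: ((c.flatMap litBlock).map some ++ some false :: some true :: rest)) by simp]
    simp only [FST.run_cons, midT_step, midStep, midT_run_uk, midT_run_lits, List.singleton_append]
    simp [KCNF.encodeClause]

/-- The clause blocks, then the field terminator: the `Γ'`-clauses, `none`, the flag, and the
transliterated context. [folklore] -/
theorem midT_run_clauses (g : Bool) (cs : CNF ℕ) (C : List (Option Bool)) :
    midT.run (.cs g) ((cs.flatMap clauseBlock).map some ++ none :: C) =
      (.cx, (cs.flatMap KCNF.encodeClause).map some ++ none :: some (Γ'.bit g) :: C.map cmap) := by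
  induction cs with
  | nil =>
    rw [List.flatMap_nil, List.map_nil, List.nil_append]
    simp only [FST.run_cons, midT_step, midStep, midT_run_cx, List.flatMap_nil, List.map_nil, List.nil_append]
    rfl
  | cons c cs ih =>
    rw [List.flatMap_cons, List.map_append, List.append_assoc, midT_run_clause, ih]
    simp

/-- The doubled header: the digits, then a comma at the `01`. [folklore] -/
theorem midT_run_hd (g : Bool) (ds : List Bool) (rest : List (Option Bool)) :
    midT.run (.hd g) ((repBits 2 ds).map some ++ some false :: some true :: rest) =
      ((midT.run (.um g) rest).1, bitsO ds ++ some Γ'.comma :: (midT.run (.um g) rest).2) := by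
  induction ds with
  | nil =>
    rw [repBits_nil, List.map_nil, List.nil_append]
    simp only [FST.run_cons, midT_step, midStep, Bool.true_eq_false, if_false, bitsO_nil, List.nil_append,
      List.singleton_append]
  | cons d ds ih =>
    rw [repBits_cons, show (List.replicate 2 d ++ repBits 2 ds).map some ++ some false :: some true :: rest =
      some d :: some d :: ((repBits 2 ds).map some ++ some false :: some true :: rest) by rfl]
    simp only [FST.run_cons, midT_step, midStep, if_true, ih, bitsO_cons, List.nil_append, List.cons_append]

/-- The unary clause count is skipped. [folklore] -/
theorem midT_run_um (g : Bool) (m : ℕ) (rest : List (Option Bool)) :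
    midT.run (.um g) ((List.replicate (2 * m) true).map some ++ some false :: some true :: rest) =
      midT.run (.cs g) rest := by
  induction m with
  | zero =>
    rw [Nat.mul_zero, List.replicate_zero, List.map_nil, List.nil_append]
    simp only [FST.run_cons, midT_step, midStep, Bool.false_eq_true, if_false, List.nil_append]
  | succ m ih =>
    rw [show 2 * (m + 1) = (2 * m + 1) + 1 by ring, List.replicate_succ, List.replicate_succ, List.map_cons,
      List.map_cons, List.cons_append, List.cons_append]
    simp only [FST.run_cons, midT_step, midStep, if_true, List.nil_append, ih]

/-- The `Γ'`-word of a header and a clause list (`KCNF.encode ⟨n, cs, _, _⟩`). [folklore] -/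
def kword (n : ℕ) (cs : CNF ℕ) : List Γ' := (encodeNat n).map Γ'.bit ++ Γ'.comma :: cs.flatMap KCNF.encodeClause

/-- `KCNF.encode` is `kword` of the fields. [folklore] -/
theorem encode_eq_kword {k : ℕ} (φ : KCNF k) : φ.encode = kword φ.numVars φ.clauses := rfl

/-- **The hand-over transducer on a front-end word**: the `Γ'`-code of the formula as a field,
`none`, the flag, and the transliterated context. [folklore] -/
theorem midT_eval (g : Bool) (n : ℕ) (cs : CNF ℕ) (C : List (Option Bool)) :
    midT.eval ((preWord g n cs).map some ++ none :: C) =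
      (kword n cs).map some ++ none :: some (Γ'.bit g) :: C.map cmap := by
  rw [midT_eval_eq, preWord_eq,
    show (g :: g :: false :: true :: (repBits 2 (encodeNat n) ++ false :: true ::
        (List.replicate (2 * cs.length) true ++ false :: true :: cs.flatMap clauseBlock))).map some ++ none :: C =
      some g :: some g :: some false :: some true :: ((repBits 2 (encodeNat n)).map some ++ some false :: some true ::
        ((List.replicate (2 * cs.length) true).map some ++ some false :: some true ::
          ((cs.flatMap clauseBlock).map some ++ none :: C))) by simp]
  simp only [FST.run_cons, midT_step, midStep, SMid.tgt, midT_run_hd, midT_run_um, midT_run_clauses,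
    List.nil_append]
  simp [kword, bitsO]

/-- The context transliteration on an answer context: ticks `bit 1`, `none`, head bits.
[folklore] -/
theorem map_cmap_ansCtx (as : List (List Bool)) :
    (ansCtx as).map cmap = List.replicate as.length (some (Γ'.bit true)) ++ none ::
      as.map fun a => some (Γ'.bit (a.headD false)) := by
  simp [ansCtx, cmap, List.map_replicate]

end Literature.Computability.FineGrained.SerfKSat
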